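import Literature.AlgebraicGeometry.Resolution.ResolutionLU
import Literature.AlgebraicGeometry.Resolution.QuasiExcellentSchemes
import Literature.AlgebraicGeometry.Resolution.ArithmeticalThreefoldsLocal
import Literature.AlgebraicGeometry.Resolution.AffineDomainDimension
import HarnessLib

/-!
# Cossart–Piltant Thm. 1.1 (as printed) ⇒ (LU) for quasi-excellent domains of dimension ≤ 3

Topic: `Literature/AlgebraicGeometry/Resolution`. With `ResolutionLU.lean` (resolution of
`Spec A` uniformizes every valuation ring over `A`) the local-uniformization leaves of the
decomposition of `CossartPiltant2019` in `ArithmeticalThreefolds.lean` become COROLLARIES of the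
printed main theorem `CossartPiltant2019General` (`QuasiExcellentSchemes.lean`) and of the
excellence facts of Stacks 07QW / 07QU:

* `CossartPiltant2019General.exists_fg_regular` — for a quasi-excellent domain `A` of Krull
  dimension `≤ 3` and a valuation ring `O ⊇ A` of `Frac A`, some finitely generated
  `A ⊆ T ⊆ O` is regular at the centre (Cossart–Piltant 2019, §4.1: (LU) "holds" for the local
  rings of the schemes of Thm. 1.1 — here for all valuations with a centre, read off Thm. 1.1 by
  the valuative criterion);
* `CossartPiltant2019General.cpLocalUniformization` — in particular `CPLocalUniformization A`
  for quasi-excellent local domains of dimension `≤ 3`;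
* `CossartPiltant2019General.luComplete3 : … → CossartPiltant2019LUComplete3` (complete
  Noetherian local rings are excellent, `Stacks07QW_complete`);
* `CossartPiltant2019.relLocalUniformization` — `CossartPiltant2019` gives
  `RelLocalUniformization k K O` whenever `trdeg_k K ≤ 3` (with `AffineDomainDimension.lean`);
* `cossartPiltant2019_leaves_of_general` — all five named facts of the two decomposition layers
  (`CossartJannsenSaito2020`, `CossartPiltant2019LU3`, `CossartPiltant2019Patching`,
  `CossartPiltant2019LUComplete3`, `CossartPiltant2019LU3OfComplete`) follow from
  `CossartPiltant2019General` and the excellence facts.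

New named fact (needed to see that `Spec A` is a quasi-excellent SCHEME in the all-affine-opens
sense of `Scheme.IsQuasiExcellent` when `A` is a quasi-excellent ring): `Stacks07QU` — a finite
type algebra over a quasi-excellent ring is quasi-excellent (Stacks, Tag 07QU = Lemma 15.53.2:
"Any localization of a finite type ring over a (quasi-)excellent ring is (quasi-)excellent";
Matsumura §32 p. 260; EGA IV₂ 7.8.3 (ii)).

## Sources

* V. Cossart, O. Piltant, J. Algebra 529 (2019) 268–535, Thm. 1.1, §4.1 (LU), Prop. 4.10
  (arXiv v1: 4.8). [CossartPiltant2019]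
* The Stacks Project, Tags 07QU (Lemma 15.53.2), 07QW. [StacksProject]
-/

noncomputable section

open CategoryTheory AlgebraicGeometry TopologicalSpace IsLocalRing

namespace Literature.AlgebraicGeometry.Resolution

universe u

/-- NAMED FACT — **finite type algebras over quasi-excellent rings are quasi-excellent**
(Stacks, Tag 07QU = Lemma 15.53.2: "Any localization of a finite type ring over a
(quasi-)excellent ring is (quasi-)excellent"; vendored for the finite type algebra itself, the
localization at `{1}`, and for quasi-excellence). Users take `(h : Stacks07QU)`.
[cite: StacksProject, Tag 07QU] -/
def Stacks07QU : Prop :=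
  ∀ (A B : Type u) [CommRing A] [CommRing B] [Algebra A B],
    IsQuasiExcellentRing A → Algebra.FiniteType A B → IsQuasiExcellentRing B

/-- Under `Stacks07QU`, a scheme locally of finite type over a quasi-excellent ring `A` is a
quasi-excellent scheme (every affine open has a coordinate ring of finite type over `A`).
[cite: StacksProject, Tag 07QU] -/
theorem Scheme.isQuasiExcellent_of_locallyOfFiniteType_of_isQuasiExcellentRing
    (h07 : Stacks07QU.{u}) {A : Type u} [CommRing A] (hA : IsQuasiExcellentRing A)
    {X : Scheme.{u}} (f : X ⟶ Spec (.of A)) [LocallyOfFiniteType f] :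
    Scheme.IsQuasiExcellent X := by
  intro U
  have hφ : RingHom.FiniteType (f.appLE ⊤ (U : X.Opens) le_top).hom :=
    HasRingHomProperty.appLE @LocallyOfFiniteType f ‹_› ⟨⊤, isAffineOpen_top _⟩ U le_top
  let e : A ≃+* Γ(Spec (.of A), ⊤) := (Scheme.ΓSpecIso (.of A)).commRingCatIsoToRingEquiv.symm
  have hψ : RingHom.FiniteType
      (((f.appLE ⊤ (U : X.Opens) le_top).hom : _ →+* _).comp e.toRingHom) :=
    hφ.comp (RingHom.FiniteType.of_surjective _ e.surjective)
  letI : Algebra A Γ(X, U) :=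
    ((((f.appLE ⊤ (U : X.Opens) le_top).hom : _ →+* _).comp e.toRingHom)).toAlgebra
  haveI : Algebra.FiniteType A Γ(X, U) := hψ
  exact h07 A Γ(X, U) hA ‹_›

/-- Under `CossartPiltant2019General` and `Stacks07QU`, `Spec A` has a resolution for every
reduced quasi-excellent ring `A` of Krull dimension `≤ 3` (Thm. 1.1 applied to the affine,
hence separated, Noetherian scheme `Spec A`). [cite: CossartPiltant2019, Thm. 1.1] -/
theorem CossartPiltant2019General.hasResolution_spec (h : CossartPiltant2019General.{u})
    (h07 : Stacks07QU.{u}) (A : Type u) [CommRing A] [_root_.IsReduced A]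
    (hA : IsQuasiExcellentRing A) (hdim : ringKrullDim A ≤ 3) :
    Scheme.HasResolution (Spec (.of A)) := by
  haveI : IsNoetherianRing A := hA.isNoetherianRing
  haveI : IsNoetherianRing (CommRingCat.of A) := ‹IsNoetherianRing A›
  have hqe := Scheme.isQuasiExcellent_of_locallyOfFiniteType_of_isQuasiExcellentRing h07 hA
    (𝟙 (Spec (.of A)))
  have hdim' : topologicalKrullDim (Spec (.of A)) ≤ 3 :=
    (le_of_eq (PrimeSpectrum.topologicalKrullDim_eq_ringKrullDim (R := A))).trans hdim
  obtain ⟨X', π, hπ, -⟩ := h (Spec (.of A)) hqe hdim'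
  exact ⟨X', π, hπ⟩

/-- **(LU) for quasi-excellent domains of dimension `≤ 3` from Thm. 1.1** (Cossart–Piltant 2019,
Thm. 1.1 with §4.1: for a quasi-excellent domain `A` of dimension `≤ 3` and every valuation ring
`O` of `Frac A` containing `A` there is a finitely generated `A`-algebra `A ⊆ T ⊆ O` with
`T_{𝔪_O ∩ T}` regular; from `CossartPiltant2019General` by the valuative criterion,
`exists_fg_regular_of_hasResolution`). [cite: CossartPiltant2019, Thm. 1.1 with §4.1 (LU)] -/
theorem CossartPiltant2019General.exists_fg_regular (h : CossartPiltant2019General.{u})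
    (h07 : Stacks07QU.{u}) {A : Type u} [CommRing A] [IsDomain A] (hA : IsQuasiExcellentRing A)
    (hdim : ringKrullDim A ≤ 3) {K : Type u} [Field K] [Algebra A K] [IsFractionRing A K]
    (O : ValuationSubring K) (hAO : ∀ a : A, algebraMap A K a ∈ O) :
    ∃ (T : Subalgebra A K) (hT : T.toSubring ≤ O.toSubring), T.FG ∧
      IsRegularLocalRing (Localization.AtPrime
        (Ideal.comap (Subring.inclusion hT) (IsLocalRing.maximalIdeal O))) :=
  exists_fg_regular_of_hasResolution O hAO (h.hasResolution_spec h07 A hA hdim)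

/-- Cossart–Piltant's (LU) (`CPLocalUniformization`) for every quasi-excellent local domain of
dimension `≤ 3`, from Thm. 1.1 (Cossart–Piltant 2019, proof of Prop. 4.10 [arXiv v1: 4.8]:
"(LU) holds for `A`" is what Thm. 1.1 restricted to `Spec A` says along valuations).
[cite: CossartPiltant2019, Thm. 1.1 with §4.1 (LU)] -/
theorem CossartPiltant2019General.cpLocalUniformization (h : CossartPiltant2019General.{u})
    (h07 : Stacks07QU.{u}) (A : Type u) [CommRing A] [IsDomain A] [IsLocalRing A]
    (hA : IsQuasiExcellentRing A) (hdim : ringKrullDim A ≤ 3) : CPLocalUniformization A := by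
  intro K _ _ _ O hAO _ _
  obtain ⟨T, hT, ⟨s, rfl⟩, hreg⟩ := h.exists_fg_regular h07 hA hdim O hAO
  exact ⟨s, hT, hreg⟩

/-- **`CossartPiltant2019LUComplete3` from Thm. 1.1**: complete Noetherian local rings are
excellent (`Stacks07QW_complete`), so Thm. 1.1 gives (LU) for complete local domains of
dimension three.
[cite: CossartPiltant2019, Cor. 1.2 and proof of Prop. 4.10 (arXiv v1: Prop. 4.8)] -/
theorem CossartPiltant2019General.luComplete3 (h : CossartPiltant2019General.{u})
    (h07 : Stacks07QU.{u}) (h07c : Stacks07QW_complete.{u}) :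
    CossartPiltant2019LUComplete3.{u} := by
  intro A _ _ _ _ _ hdim
  exact h.cpLocalUniformization h07 A (h07c A).isQuasiExcellentRing (le_of_eq hdim)

/-- **All leaves of the decomposition from the printed Thm. 1.1**: under
`CossartPiltant2019General` and the excellence facts `Stacks07QW_field`, `Stacks07QW_complete`,
`Stacks07QU`, the five named facts of the two decomposition layers of `ArithmeticalThreefolds.lean`
hold. [cite: CossartPiltant2019, Thm. 1.1] -/
theorem cossartPiltant2019_leaves_of_general (h : CossartPiltant2019General.{u})
    (h07f : Stacks07QW_field.{u}) (h07c : Stacks07QW_complete.{u}) (h07 : Stacks07QU.{u}) :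
    CossartJannsenSaito2020.{u} ∧ CossartPiltant2019LU3.{u} ∧ CossartPiltant2019Patching.{u} ∧
      CossartPiltant2019LUComplete3.{u} ∧ CossartPiltant2019LU3OfComplete.{u} :=
  have hCP : CossartPiltant2019.{u} := h.cossartPiltant2019 h07f
  ⟨hCP.cossartJannsenSaito2020, hCP.lu3, fun k _ _ _ => cossartPiltant2019_iff.mp hCP k,
    h.luComplete3 h07 h07c, fun _ => hCP.lu3⟩

/-- **`CossartPiltant2019` ⇒ relative local uniformization in transcendence degree `≤ 3`**:
for every field `k`, every function field `K/k` with `trdeg_k K ≤ 3` and every valuation ring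
`O` of `K`, `RelLocalUniformization k K O` (via `CossartPiltant2019.lu3` and the dimension
theorem `dim = trdeg`, `AffineDomainDimension.lean`).
[cite: CossartPiltant2019, Thm. 1.1 with §4.1 (LU)] -/
theorem CossartPiltant2019.relLocalUniformization (h : CossartPiltant2019.{0}) (k K : Type)
    [Field k] [Field K] [Algebra k K] (hK : Algebra.trdeg k K ≤ 3) (O : ValuationSubring K) :
    RelLocalUniformization k K O :=
  h.lu3.relLocalUniformization k K hK O

end Literature.AlgebraicGeometry.Resolution

end
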